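import Mathlib
import Summits.KontsevichZagierPeriods.Zeta5Search.FamilyCellDAtlas
import HarnessLib

/-!
# ζ(5) search — class atlas of the family `n·(3t+8; t+6,…,t)` at `(t+3)n < 2p < (t+4)n`, part 2: the palindromic six-point classes,
# the conjugations, and `E_x ≥ −7` off the minimal classes

Cell `pub-zeta5` (HONEST FRAMING: systematic search; no irrationality claim unless certified), P1 prover seat
generation 6; continues `FamilyCellDAtlas.lean` (`m = tn`, `N = 3m + 8n`, `t ≥ 10`).  Contents: the net exponents of the
six-point palindromic classes `FMinP` (for `b` and `b + e₇`); the conjugation maps `x ↦ N − (x+4p)` (`FMinT1 ↔ FMinT2`,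
`FMinS ↔ FMinS`) and `x ↦ N − (x+5p)` (`FMinP ↔ FMinP`); and **`classExpF_ge_of_notMin`**: for `x < p` outside
`FMinT1 ∪ FMinS ∪ FMinT2 ∪ FMinP` the class exponent is `≥ −7` (gen-2 g9's face-certificate claims D1/D2, REPORT-gen2-g9 §8,
for all `n` and all `t ≥ 10` by hand), by the position of the second class point `x + p` relative to `m`:
`x + p < m` (six points `(1,1,e₂,e₃,e₄,1)`; the only escape to `−8` is the palindrome `(1,1,−6,−6,1,1)`, whose SELF-CONJUGATE
instances `2x + 5p = N` carry the odd centre and have `E = −7`), `m ≤ x+p < m+n`, `m+n ≤ x+p < m+2n` off `FMinT1`,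
`m+2n ≤ x+p < m+3n` off `FMinS` (even centre at `x+2p` allowed), `m+3n ≤ x+p` off `FMinT2`.  Exact arithmetic, linear in
`(m, n, x, p)`; nothing about irrationality.
-/

open Finset

namespace Summit.KontsevichZagierPeriods.Zeta5Search.CellD

open Summit.KontsevichZagierPeriods.Zeta5Search.ClusterValuation
open Summit.KontsevichZagierPeriods.Zeta5Search.CasoratianValuation (shift)
open Summit.KontsevichZagierPeriods.Zeta5Search.BigPrime (block shift_zero)
open Summit.KontsevichZagierPeriods.Zeta5Search.CellAtlas (bFam)
open Summit.KontsevichZagierPeriods.Zeta5Search.CellA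

/-! ### §4 The six-point palindromic classes and the conjugations -/

section MinExpsP

variable {t n p : ℕ} (ht : 10 ≤ t) (hp : t * n + 3 * n < 2 * p) (hp' : 2 * p < t * n + 4 * n)

include ht hp hp' in
/-- Net exponents of a class of `FMinP`: `(1,1,−6,−6,1,1)`, also for `b + e₇`; six points; centre-free. -/
theorem netExp_fminP {x : ℕ} (hx : x ∈ FMinP t n p) :
    (netExp (bFam t n) x = 1 ∧ netExp (bFam t n) (x + p) = 1 ∧ netExp (bFam t n) (x + 2 * p) = -6 ∧
      netExp (bFam t n) (x + 3 * p) = -6 ∧ netExp (bFam t n) (x + 4 * p) = 1 ∧ netExp (bFam t n) (x + 5 * p) = 1) ∧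
    (netExp (shift (bFam t n) 7) x = 1 ∧ netExp (shift (bFam t n) 7) (x + p) = 1 ∧
      netExp (shift (bFam t n) 7) (x + 2 * p) = -6 ∧ netExp (shift (bFam t n) 7) (x + 3 * p) = -6 ∧
      netExp (shift (bFam t n) 7) (x + 4 * p) = 1 ∧ netExp (shift (bFam t n) 7) (x + 5 * p) = 1) ∧
    x < p ∧ x + 5 * p ≤ 3 * (t * n) + 8 * n ∧ 3 * (t * n) + 8 * n < x + 5 * p + p ∧
      2 * x + 4 * p ≠ 3 * (t * n) + 8 * n ∧ 2 * x + 5 * p ≠ 3 * (t * n) + 8 * n := by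
  have h10 : 10 * n ≤ t * n := Nat.mul_le_mul_right n ht
  rw [mem_fminP] at hx
  obtain ⟨hxp, h17, h24, hself⟩ := hx
  have e0 : netExp (bFam t n) x = 1 := by
    rw [netExp_bFam_of_ne t n x (by omega), depF_low (by omega)]; norm_num
  have e1 : netExp (bFam t n) (x + p) = 1 := by
    rw [netExp_bFam_of_ne t n (x + p) (by omega), depF_low (by omega)]; norm_num
  have e2 : netExp (bFam t n) (x + 2 * p) = -6 := by
    rw [netExp_bFam_of_ne t n (x + 2 * p) (by omega), depF_well (by omega) (by omega)]; norm_num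
  have e3 : netExp (bFam t n) (x + 3 * p) = -6 := by
    rw [netExp_bFam_of_ne t n (x + 3 * p) (by omega), depF_well (by omega) (by omega)]; norm_num
  have e4 : netExp (bFam t n) (x + 4 * p) = 1 := by
    rw [netExp_bFam_of_ne t n (x + 4 * p) (by omega), depF_high (by omega)]; norm_num
  have e5 : netExp (bFam t n) (x + 5 * p) = 1 := by
    rw [netExp_bFam_of_ne t n (x + 5 * p) (by omega), depF_high (by omega)]; norm_num
  refine ⟨⟨e0, e1, e2, e3, e4, e5⟩, ⟨?_, ?_, ?_, ?_, ?_, ?_⟩, hxp, by omega, by omega, by omega, hself⟩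
  · rw [netExp_shiftF7 t n x (by omega) (by omega), e0]
  · rw [netExp_shiftF7 t n (x + p) (by omega) (by omega), e1]
  · rw [netExp_shiftF7 t n (x + 2 * p) (by omega) (by omega), e2]
  · rw [netExp_shiftF7 t n (x + 3 * p) (by omega) (by omega), e3]
  · rw [netExp_shiftF7 t n (x + 4 * p) (by omega) (by omega), e4]
  · rw [netExp_shiftF7 t n (x + 5 * p) (by omega) (by omega), e5]

end MinExpsP

/-- The conjugation `x ↦ N − (x + 4p)` maps `FMinT1` onto `FMinT2` … -/
theorem conj_mem_fminT2 {t n p x : ℕ} (hx : x ∈ FMinT1 t n p) : 3 * (t * n) + 8 * n - (x + 4 * p) ∈ FMinT2 t n p := by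
  rw [mem_fminT1] at hx; rw [mem_fminT2]; omega

/-- … and `FMinT2` back onto `FMinT1` … -/
theorem conj_mem_fminT1 {t n p x : ℕ} (ht : 10 ≤ t) (hx : x ∈ FMinT2 t n p) :
    3 * (t * n) + 8 * n - (x + 4 * p) ∈ FMinT1 t n p := by
  have h10 : 10 * n ≤ t * n := Nat.mul_le_mul_right n ht
  rw [mem_fminT2] at hx; rw [mem_fminT1]; omega

/-- … and `FMinS` onto itself … -/
theorem conj_mem_fminSD {t n p x : ℕ} (hp : t * n + 3 * n < 2 * p) (hx : x ∈ FMinS t n p) :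
    3 * (t * n) + 8 * n - (x + 4 * p) ∈ FMinS t n p := by
  rw [mem_fminS'] at hx ⊢; omega

/-- … and `x ↦ N − (x + 5p)` maps `FMinP` onto itself. -/
theorem conj_mem_fminP {t n p x : ℕ} (hp : t * n + 3 * n < 2 * p) (hp' : 2 * p < t * n + 4 * n) (hx : x ∈ FMinP t n p) :
    3 * (t * n) + 8 * n - (x + 5 * p) ∈ FMinP t n p := by
  rw [mem_fminP] at hx ⊢; omega


/-! ### §5 Every other class has `E_x ≥ −7` -/

section NotMin

variable {t n p x : ℕ} (ht : 10 ≤ t) (hp : t * n + 3 * n < 2 * p) (hp' : 2 * p < t * n + 4 * n) (hx : x < p)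

include ht hp hp' hx in
/-- Region `x + p < m`: six points `(1, 1, e₂, e₃, e₄, 1)`; `E ≥ −7` unless the class is the centre-free palindrome `FMinP`
(a self-conjugate palindrome `2x + 5p = N` has `E = −8 + 1`). -/
theorem classExpF_R0 (hodd : ¬ 2 ∣ p) (h11 : x + p < t * n)
    (hP : x + 2 * p < t * n + 6 * n ∨ 2 * (t * n) + 2 * n < x + 3 * p ∨ 2 * x + 5 * p = 3 * (t * n) + 8 * n) :
    -7 ≤ classExp (bFam t n) p x := by
  have h10 : 10 * n ≤ t * n := Nat.mul_le_mul_right n ht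
  have e0 : netExp (bFam t n) x = 1 := by
    rw [netExp_bFam_of_ne t n x (by omega), depF_low (by omega)]; norm_num
  have e1 : netExp (bFam t n) (x + p) = 1 := by
    rw [netExp_bFam_of_ne t n (x + p) (by omega), depF_low (by omega)]; norm_num
  have a1 : x + 2 * p < t * n + 4 * n → netExp (bFam t n) (x + 2 * p) = -3 := fun h => by
    rw [netExp_bFam_of_ne t n (x + 2 * p) (by omega), depF_lower7 (k := 4) (by norm_num) (by norm_num) (by omega)
      (by omega) (by omega)]; norm_num
  have a2 : t * n + 4 * n ≤ x + 2 * p → x + 2 * p < t * n + 5 * n → netExp (bFam t n) (x + 2 * p) = -4 := fun h h' => by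
    rw [netExp_bFam_of_ne t n (x + 2 * p) (by omega), depF_lower7 (k := 5) (by norm_num) (by norm_num) (by omega)
      (by omega) (by omega)]; norm_num
  have a3 : t * n + 5 * n ≤ x + 2 * p → x + 2 * p < t * n + 6 * n → netExp (bFam t n) (x + 2 * p) = -5 := fun h h' => by
    rw [netExp_bFam_of_ne t n (x + 2 * p) (by omega), depF_lower7 (k := 6) (by norm_num) (by norm_num) (by omega)
      (by omega) (by omega)]; norm_num
  have a4 : t * n + 6 * n ≤ x + 2 * p → netExp (bFam t n) (x + 2 * p) = -6 := fun h => by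
    rw [netExp_bFam_of_ne t n (x + 2 * p) (by omega), depF_well (by omega) (by omega)]; norm_num
  have b1 : x + 3 * p ≤ 2 * (t * n) + 2 * n → netExp (bFam t n) (x + 3 * p) = -6 := fun h => by
    rw [netExp_bFam_of_ne t n (x + 3 * p) (by omega), depF_well (by omega) (by omega)]; norm_num
  have b2 : 2 * (t * n) + 2 * n < x + 3 * p → x + 3 * p ≤ 2 * (t * n) + 3 * n → netExp (bFam t n) (x + 3 * p) = -5 :=
    fun h h' => by
    rw [netExp_bFam_of_ne t n (x + 3 * p) (by omega), depF_upper7 (k := 6) (by norm_num) (by norm_num) (by omega)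
      (by omega) (by omega)]; norm_num
  have b3 : 2 * (t * n) + 3 * n < x + 3 * p → netExp (bFam t n) (x + 3 * p) = -4 := fun h => by
    rw [netExp_bFam_of_ne t n (x + 3 * p) (by omega), depF_upper7 (k := 5) (by norm_num) (by norm_num) (by omega)
      (by omega) (by omega)]; norm_num
  have c1 : x + 4 * p ≤ 2 * (t * n) + 7 * n → netExp (bFam t n) (x + 4 * p) = -1 := fun h => by
    rw [netExp_bFam_of_ne t n (x + 4 * p) (by omega), depF_upper7 (k := 2) (by norm_num) (by norm_num) (by omega)
      (by omega) (by omega)]; norm_num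
  have c2 : 2 * (t * n) + 7 * n < x + 4 * p → x + 4 * p ≤ 2 * (t * n) + 8 * n → netExp (bFam t n) (x + 4 * p) = 0 :=
    fun h h' => by
    rw [netExp_bFam_of_ne t n (x + 4 * p) (by omega), depF_upper7 (k := 1) (by norm_num) (by norm_num) (by omega)
      (by omega) (by omega)]; norm_num
  have c3 : 2 * (t * n) + 8 * n < x + 4 * p → netExp (bFam t n) (x + 4 * p) = 1 := fun h => by
    rw [netExp_bFam_of_ne t n (x + 4 * p) (by omega), depF_high (by omega)]; norm_num
  have e5 : netExp (bFam t n) (x + 5 * p) = 1 := by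
    rw [netExp_bFam_of_ne t n (x + 5 * p) (by omega), depF_high (by omega)]; norm_num
  have hE := classExpF_ge_six ht hp hp' hx (by omega)
  have hEc : 2 * x + 5 * p = 3 * (t * n) + 8 * n → classExp (bFam t n) p x = netExp (bFam t n) x +
      netExp (bFam t n) (x + p) + netExp (bFam t n) (x + 2 * p) + netExp (bFam t n) (x + 3 * p) +
      netExp (bFam t n) (x + 4 * p) + netExp (bFam t n) (x + 5 * p) + 1 := fun h => classExpF_six_centre ht hp hp' hx hodd h
  omega

include ht hp hp' hx in
/-- Region `m ≤ x + p < m + n`: `(1, 0, −6, −4|−3, 1 [,1])`, and the sixth point is present when `e₃ = −4`. -/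
theorem classExpF_R1' (h11 : t * n ≤ x + p) (h12 : x + p < t * n + n) : -7 ≤ classExp (bFam t n) p x := by
  have h10 : 10 * n ≤ t * n := Nat.mul_le_mul_right n ht
  have e0 : netExp (bFam t n) x = 1 := by
    rw [netExp_bFam_of_ne t n x (by omega), depF_low (by omega)]; norm_num
  have e1 : netExp (bFam t n) (x + p) = 0 := by
    rw [netExp_bFam_of_ne t n (x + p) (by omega), depF_lower7 (k := 1) (by norm_num) (by norm_num) (by omega) (by omega)
      (by omega)]; norm_num
  have e2 : netExp (bFam t n) (x + 2 * p) = -6 := by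
    rw [netExp_bFam_of_ne t n (x + 2 * p) (by omega), depF_well (by omega) (by omega)]; norm_num
  have b1 : x + 3 * p ≤ 2 * (t * n) + 4 * n → netExp (bFam t n) (x + 3 * p) = -4 := fun h => by
    rw [netExp_bFam_of_ne t n (x + 3 * p) (by omega), depF_upper7 (k := 5) (by norm_num) (by norm_num) (by omega)
      (by omega) (by omega)]; norm_num
  have b2 : 2 * (t * n) + 4 * n < x + 3 * p → netExp (bFam t n) (x + 3 * p) = -3 := fun h => by
    rw [netExp_bFam_of_ne t n (x + 3 * p) (by omega), depF_upper7 (k := 4) (by norm_num) (by norm_num) (by omega)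
      (by omega) (by omega)]; norm_num
  have e4 : netExp (bFam t n) (x + 4 * p) = 1 := by
    rw [netExp_bFam_of_ne t n (x + 4 * p) (by omega), depF_high (by omega)]; norm_num
  by_cases h6 : x + 5 * p ≤ 3 * (t * n) + 8 * n
  · have e5 : netExp (bFam t n) (x + 5 * p) = 1 := by
      rw [netExp_bFam_of_ne t n (x + 5 * p) (by omega), depF_high (by omega)]; norm_num
    have hE := classExpF_ge_six ht hp hp' hx h6
    omega
  · have hE := classExpF_ge_five ht hp hp' hx h6
    omega

include ht hp hp' hx in
/-- Region `m + n ≤ x + p < m + 2n` outside `FMinT1`: `(1, −1, −6, −3|−2, 1 [,1])` with `e₃ = −2` or a sixth point. -/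
theorem classExpF_R2' (h12 : t * n + n ≤ x + p) (h13 : x + p < t * n + 2 * n)
    (hT1 : 2 * (t * n) + 5 * n < x + 3 * p ∨ x + 5 * p ≤ 3 * (t * n) + 8 * n) : -7 ≤ classExp (bFam t n) p x := by
  have h10 : 10 * n ≤ t * n := Nat.mul_le_mul_right n ht
  have e0 : netExp (bFam t n) x = 1 := by
    rw [netExp_bFam_of_ne t n x (by omega), depF_low (by omega)]; norm_num
  have e1 : netExp (bFam t n) (x + p) = -1 := by
    rw [netExp_bFam_of_ne t n (x + p) (by omega), depF_lower7 (k := 2) (by norm_num) (by norm_num) (by omega) (by omega)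
      (by omega)]; norm_num
  have e2 : netExp (bFam t n) (x + 2 * p) = -6 := by
    rw [netExp_bFam_of_ne t n (x + 2 * p) (by omega), depF_well (by omega) (by omega)]; norm_num
  have b1 : x + 3 * p ≤ 2 * (t * n) + 5 * n → netExp (bFam t n) (x + 3 * p) = -3 := fun h => by
    rw [netExp_bFam_of_ne t n (x + 3 * p) (by omega), depF_upper7 (k := 4) (by norm_num) (by norm_num) (by omega)
      (by omega) (by omega)]; norm_num
  have b2 : 2 * (t * n) + 5 * n < x + 3 * p → netExp (bFam t n) (x + 3 * p) = -2 := fun h => by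
    rw [netExp_bFam_of_ne t n (x + 3 * p) (by omega), depF_upper7 (k := 3) (by norm_num) (by norm_num) (by omega)
      (by omega) (by omega)]; norm_num
  have e4 : netExp (bFam t n) (x + 4 * p) = 1 := by
    rw [netExp_bFam_of_ne t n (x + 4 * p) (by omega), depF_high (by omega)]; norm_num
  by_cases h6 : x + 5 * p ≤ 3 * (t * n) + 8 * n
  · have e5 : netExp (bFam t n) (x + 5 * p) = 1 := by
      rw [netExp_bFam_of_ne t n (x + 5 * p) (by omega), depF_high (by omega)]; norm_num
    have hE := classExpF_ge_six ht hp hp' hx h6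
    omega
  · have hE := classExpF_ge_five ht hp hp' hx h6
    omega

include ht hp hp' hx in
/-- Region `m + 2n ≤ x + p < m + 3n` outside `FMinS`: five points `(1, −2, −6|−5, −2|−1, 1)` with `e₃ = −1` or the even
centre at `x + 2p`. -/
theorem classExpF_R3' (h13 : t * n + 2 * n ≤ x + p) (h14 : x + p < t * n + 3 * n)
    (hS : 2 * (t * n) + 6 * n < x + 3 * p ∨ 2 * x + 4 * p = 3 * (t * n) + 8 * n) : -7 ≤ classExp (bFam t n) p x := by
  have h10 : 10 * n ≤ t * n := Nat.mul_le_mul_right n ht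
  have e0 : netExp (bFam t n) x = 1 := by
    rw [netExp_bFam_of_ne t n x (by omega), depF_low (by omega)]; norm_num
  have e1 : netExp (bFam t n) (x + p) = -2 := by
    rw [netExp_bFam_of_ne t n (x + p) (by omega), depF_lower7 (k := 3) (by norm_num) (by norm_num) (by omega) (by omega)
      (by omega)]; norm_num
  have a1 : 2 * x + 4 * p ≠ 3 * (t * n) + 8 * n → netExp (bFam t n) (x + 2 * p) = -6 := fun h => by
    rw [netExp_bFam_of_ne t n (x + 2 * p) (by omega), depF_well (by omega) (by omega)]; norm_num
  have a2 : 2 * x + 4 * p = 3 * (t * n) + 8 * n → netExp (bFam t n) (x + 2 * p) = -5 := fun h =>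
    netExpF_centre (by omega) (by omega)
  have b1 : x + 3 * p ≤ 2 * (t * n) + 6 * n → netExp (bFam t n) (x + 3 * p) = -2 := fun h => by
    rw [netExp_bFam_of_ne t n (x + 3 * p) (by omega), depF_upper7 (k := 3) (by norm_num) (by norm_num) (by omega)
      (by omega) (by omega)]; norm_num
  have b2 : 2 * (t * n) + 6 * n < x + 3 * p → netExp (bFam t n) (x + 3 * p) = -1 := fun h => by
    rw [netExp_bFam_of_ne t n (x + 3 * p) (by omega), depF_upper7 (k := 2) (by norm_num) (by norm_num) (by omega)
      (by omega) (by omega)]; norm_num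
  have e4 : netExp (bFam t n) (x + 4 * p) = 1 := by
    rw [netExp_bFam_of_ne t n (x + 4 * p) (by omega), depF_high (by omega)]; norm_num
  have hE := classExpF_ge_five ht hp hp' hx (by omega)
  omega

include ht hp hp' hx in
/-- Region `m + 3n ≤ x + p` outside `FMinT2`: five points `(1, −3, −6, 0, 1)`. -/
theorem classExpF_R4' (h14 : t * n + 3 * n ≤ x + p) (hT2 : 2 * (t * n) + 7 * n < x + 3 * p) :
    -7 ≤ classExp (bFam t n) p x := by
  have h10 : 10 * n ≤ t * n := Nat.mul_le_mul_right n ht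
  have e0 : netExp (bFam t n) x = 1 := by
    rw [netExp_bFam_of_ne t n x (by omega), depF_low (by omega)]; norm_num
  have e1 : netExp (bFam t n) (x + p) = -3 := by
    rw [netExp_bFam_of_ne t n (x + p) (by omega), depF_lower7 (k := 4) (by norm_num) (by norm_num) (by omega) (by omega)
      (by omega)]; norm_num
  have e2 : netExp (bFam t n) (x + 2 * p) = -6 := by
    rw [netExp_bFam_of_ne t n (x + 2 * p) (by omega), depF_well (by omega) (by omega)]; norm_num
  have e3 : netExp (bFam t n) (x + 3 * p) = 0 := by
    rw [netExp_bFam_of_ne t n (x + 3 * p) (by omega), depF_upper7 (k := 1) (by norm_num) (by norm_num) (by omega)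
      (by omega) (by omega)]; norm_num
  have e4 : netExp (bFam t n) (x + 4 * p) = 1 := by
    rw [netExp_bFam_of_ne t n (x + 4 * p) (by omega), depF_high (by omega)]; norm_num
  have hE := classExpF_ge_five ht hp hp' hx (by omega)
  omega

include ht hp hp' hx in
/-- **THE NON-MINIMAL CLASSES**: for `x < p` outside `FMinT1 ∪ FMinS ∪ FMinT2 ∪ FMinP`, `E_x(b, p) ≥ −7`. -/
theorem classExpF_ge_of_notMin (hodd : ¬ 2 ∣ p) (h1 : x ∉ FMinT1 t n p) (h2 : x ∉ FMinS t n p) (h3 : x ∉ FMinT2 t n p)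
    (h4 : x ∉ FMinP t n p) : -7 ≤ classExp (bFam t n) p x := by
  rw [mem_fminT1] at h1; rw [mem_fminS'] at h2; rw [mem_fminT2] at h3; rw [mem_fminP] at h4
  by_cases h11 : x + p < t * n
  · refine classExpF_R0 ht hp hp' hx hodd h11 ?_
    by_contra hc; push Not at hc; exact h4 ⟨hx, hc.1, hc.2.1, hc.2.2⟩
  push Not at h11
  by_cases h12 : x + p < t * n + n
  · exact classExpF_R1' ht hp hp' hx h11 h12
  push Not at h12
  by_cases h13 : x + p < t * n + 2 * n
  · refine classExpF_R2' ht hp hp' hx h12 h13 ?_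
    by_contra hc; push Not at hc; exact h1 ⟨hx, h12, hc.1, hc.2⟩
  push Not at h13
  by_cases h14 : x + p < t * n + 3 * n
  · refine classExpF_R3' ht hp hp' hx h13 h14 ?_
    by_contra hc; push Not at hc; exact h2 ⟨hx, h13, hc.1, hc.2⟩
  push Not at h14
  refine classExpF_R4' ht hp hp' hx h14 ?_
  by_contra hc; push Not at hc; exact h3 ⟨hx, h14, hc⟩

include ht hp hp' hx in
/-- … hence `ν_x(b, p) ≥ −7` there. -/
theorem classNuF_ge_of_notMin (hodd : ¬ 2 ∣ p) (h1 : x ∉ FMinT1 t n p) (h2 : x ∉ FMinS t n p) (h3 : x ∉ FMinT2 t n p)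
    (h4 : x ∉ FMinP t n p) : -7 ≤ classNu (bFam t n) p x :=
  (classExpF_ge_of_notMin ht hp hp' hx hodd h1 h2 h3 h4).trans (classExp_le_classNu _ _ _)

end NotMin

end Summit.KontsevichZagierPeriods.Zeta5Search.CellD
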